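import Mathlib
import HarnessLib
import Literature.AlgebraicGeometry.Resolution.BlowupChartRsop
import Summits.ResolutionOfSingularities.ResolutionOfSingularities.Theorems.WildQuotientsWildQuotientResolutionS1aKillCertCoverEq
import Summits.ResolutionOfSingularities.ResolutionOfSingularities.Theorems.WildQuotientsWildQuotientResolutionS1aKillJordanChain
import Summits.ResolutionOfSingularities.ResolutionOfSingularities.Theorems.WildQuotientsWildQuotientResolutionS1aStubInitialAtlas

/-!
# S1a — THE KILL MACHINERY AT AN ACTUAL MODEL: the Jordan block `J₄` has a PRINCIPAL CENTRE on the initial model, supported on the fixed axis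

[OURS · L1 W4.5c · lead-1 g10; FRAME-STATUS rev11 §4 item 4 / (F6)] — NOT statements of the manuscript; counted 0; AI-level work, weaker than expert review.
Crux stmt-ResolutionOfSingularities-17941 `CyclicQuotientFourfolds`, line `s1a-logminvertex` v10, K-side. END-TO-END check of the typed K pipeline on a
`GameFrame.GModel`: ring certificate (`cobordantKillCert_jordanChainThree`) ⇒ principal chart data on the initial node ⇒ `IsPrincipalCentre` on the initial
model (`exists_isPrincipalCentre_filtration_eq_of_certCover` with ONE chart), the centre being THE (3,2,1)-weighted filtration on the fixed axis.

The DATUM is abstracted to what the pipeline needs: an affine regular `X′` (locally Noetherian, separated) with `G → Aut X′` commuting with an affine `q` to a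
separated `X₁`, `g₀ ^ p = 1`, and a ring isomorphism `e : Γ(X′, ⊤) ≃ k[x₀..x₃]` that INTERTWINES the action of `g₀` on global sections with the Jordan block
`σ` (`x₀ ↦ x₀`, `x_{i+1} ↦ x_{i+1} + x_i`). For `X′ = Spec k[x]`, `ρ g = Spec(g⁻¹)` (`AffineQuotient.exists_specAction`), `e = ΓSpecIso` this is the JordanBlockFourfold
datum; the theorem below does not re-derive that plumbing.
* `IsRegular.of_ringEquiv_ofFn`, `isRegularRing_quotient_of_ringEquiv` — K1′ data transport along ring isomorphisms;
* ★★★ `exists_isPrincipalCentre_initial_of_jordanBlock` — on `GModel.initial hq h₀`: `∃ 𝒦 d, IsPrincipalCentre p _ g₀ 𝒦 d`, with `𝒦|_{X′} = 𝒥_•((x₀,x₁,x₂), (3,2,1))`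
  (through `e`), `supp 𝒦_d = V(x₀, x₁, x₂)` the fixed axis, and `X′` itself a principal-centre chart — the one-move kill of `J₄` as a MOVE OF THE GAME (all `p`).
-/

set_option linter.dupNamespace false

noncomputable section

open CategoryTheory Limits AlgebraicGeometry TopologicalSpace Topology Opposite MvPolynomial
open Literature.AlgebraicGeometry.Resolution Literature.AlgebraicGeometry.RelativeSpec
open Summit.ResolutionOfSingularities.ResolutionOfSingularities.Theorems.WildQuotientResolution.S1
open Summit.ResolutionOfSingularities.ResolutionOfSingularities.Theorems.WildQuotientResolution.S1.NodeAtlas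
open Summit.ResolutionOfSingularities.ResolutionOfSingularities.Theorems.WildQuotientResolution.S1.KillCert
open Summit.ResolutionOfSingularities.ResolutionOfSingularities.Theorems.WildQuotientResolution.S1.GoodCharts

namespace Summit.ResolutionOfSingularities.ResolutionOfSingularities.Theorems.WildQuotientResolution.S1.KillCert

/-! ## K1′ data along ring isomorphisms -/

/-- A ring isomorphism carries regular sequences (of the ring on itself) to regular sequences. [folklore] -/
theorem IsRegular.of_ringEquiv_ofFn {S S' : Type*} [CommRing S] [CommRing S'] (ε : S ≃+* S') {c : ℕ} (f : Fin c → S)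
    (h : RingTheory.Sequence.IsRegular S (List.ofFn f)) : RingTheory.Sequence.IsRegular S' (List.ofFn (⇑ε ∘ f)) := by
  have hl : List.ofFn (⇑ε ∘ f) = (List.ofFn f).map ε := by rw [List.map_ofFn]
  refine ⟨by rw [hl]; exact (RingEquiv.isWeaklyRegular_map_iff ε _).mpr h.toIsWeaklyRegular, ?_⟩
  intro htop
  apply h.top_ne_smul
  rw [smul_eq_mul, Ideal.mul_top] at htop ⊢
  rw [CentreAway.ofList_ofFn] at htop ⊢
  rw [Set.range_comp, ← Ideal.map_span] at htop
  exact ((Ideal.map_eq_top_of_bijective ε ε.bijective).mp htop.symm).symm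

/-- A ring isomorphism carries regularity of the quotient by the centre. [folklore] -/
theorem isRegularRing_quotient_of_ringEquiv {S S' : Type*} [CommRing S] [CommRing S'] (ε : S ≃+* S') {c : ℕ} (f : Fin c → S)
    (h : IsRegularRing (S ⧸ Ideal.span (Set.range f))) : IsRegularRing (S' ⧸ Ideal.span (Set.range (⇑ε ∘ f))) := by
  haveI := h
  refine IsRegularRing.of_ringEquiv (Ideal.quotientEquiv (Ideal.span (Set.range f)) (Ideal.span (Set.range (⇑ε ∘ f))) ε ?_)
  rw [Ideal.map_span, Set.range_comp]
  rfl

end Summit.ResolutionOfSingularities.ResolutionOfSingularities.Theorems.WildQuotientResolution.S1.KillCert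

namespace Summit.ResolutionOfSingularities.ResolutionOfSingularities.Theorems.WildQuotientResolution.S1.GameFrame.GModel

open KillCert

variable {p : ℕ} {X' X₁ : Scheme.{0}} {q : X' ⟶ X₁} {G : Type} [Group G] {ρ : G →* Aut X'} {g₀ : G}

/-- ★★★ **THE JORDAN BLOCK `J₄` IS KILLED BY ONE MOVE OF THE GAME.** Let `(X′, X₁, q, ρ, g₀)` be action data with `X′` AFFINE, regular, locally Noetherian and
separated, `X₁` separated, `q` affine and `G`-invariant, `G` finite, `g₀ ^ p = 1`, and let `e : Γ(X′, ⊤) ≃+* k[x₀..x₃]` intertwine the action of `g₀` on global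
sections with the Jordan block `σ` (`σ x₀ = x₀`, `σ x_{i+1} = x_{i+1} + x_i`, `σ` fixing constants). Then on the INITIAL MODEL the (3,2,1)-weighted centre on the
fixed axis IS a legal PRINCIPAL (kill) move: `∃ 𝒦 d, IsPrincipalCentre p _ g₀ 𝒦 d` whose filtration on `X′` is `𝒥ₙ((e⁻¹x₀, e⁻¹x₁, e⁻¹x₂), (3,2,1))`, whose
support is EXACTLY the fixed axis `V(e⁻¹x₀, e⁻¹x₁, e⁻¹x₂)`, and for which every stable affine chart with underlying open `⊤` (i.e. `X′`) is a principal-centre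
chart. [OURS · L1 W4.5c · FRAME-STATUS rev11 §4 (4); NOT a statement of the manuscript] -/
theorem exists_isPrincipalCentre_initial_of_jordanBlock [Finite G] (hp : 0 < p) (hG : ∀ g : G, g ∈ Subgroup.zpowers g₀) (hg₀ : g₀ ^ p = 1)
    (hq : ∀ g : G, (ρ g).hom ≫ q = q) [IsIntegral X'] [IsLocallyNoetherian X'] [X'.IsSeparated] [IsAffine X'] [X₁.IsSeparated] [IsAffineHom q]
    (hreg : Scheme.IsRegular X') {k : Type} [Field k] (σ : MvPolynomial (Fin 4) k ≃+* MvPolynomial (Fin 4) k) (hC : ∀ a : k, σ (C a) = C a)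
    (h0 : σ (X 0) = X 0) (h1 : σ (X 1) = X 1 + X 0) (h2 : σ (X 2) = X 2 + X 1) (h3 : σ (X 3) = X 3 + X 2)
    (e : Γ(X', ⊤) ≃+* MvPolynomial (Fin 4) k)
    (hστ : ∀ t : Γ(X', ⊤), e ((ρ g₀⁻¹).hom.appLE ⊤ ⊤ (by rw [Scheme.Hom.preimage_top]) t) = σ (e t)) :
    letI h₀ : NodeAtlas p (⟨ρ, hq⟩ : ActionOver q G) g₀ := stub_initialAtlas p hp q G ρ g₀ hg₀ hq hreg
    ∃ (𝒦 : ReesFiltration X') (d : ℕ), IsPrincipalCentre p (GModel.initial hq h₀).act g₀ 𝒦 d ∧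
      (∀ n, (𝒦.filtration ⟨⊤, isAffineOpen_top X'⟩).ideal n = (weightedFiltration (e.symm ∘ ![X 0, X 1, X 2]) ![3, 2, 1]).ideal n) ∧
      (((𝒦.ideal d).support : Set X')) = X'.zeroLocus (U := ⊤) (Set.range (e.symm ∘ ![X 0, X 1, X 2])) ∧
      ∀ O : (GModel.initial hq h₀).act.StableAffineOpens, O.1 = ⊤ → IsPrincipalCentreChart p (GModel.initial hq h₀).act g₀ 𝒦 d O := by
  classical
  -- the one chart: all of `X′`, affine over `X₁`
  haveI : IsAffine (⊤ : X'.Opens) := isAffineOpen_top X'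
  have hAff : IsAffineHom ((⊤ : X'.Opens).ι ≫ q) := inferInstance
  have hst : ∀ g : G, (ρ g).hom ⁻¹ᵁ (⊤ : X'.Opens) = ⊤ := fun g => Scheme.Hom.preimage_top _
  let O : (⟨ρ, hq⟩ : ActionOver q G).StableAffineOpens := ⟨⊤, hst, hAff⟩
  have hO : IsAffineOpen O.1 := isAffineOpen_top X'
  haveI hsep : (GModel.initial hq (stub_initialAtlas p hp q G ρ g₀ hg₀ hq hreg) : GModel p q G ρ g₀).V.IsSeparated := ‹X'.IsSeparated›
  -- the frame in `A = Γ(X′, ⊤)` and the automorphism `τ = g₀` acting on it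
  let A := Γ(X', (⊤ : X'.Opens))
  let τ : A ≃+* A := actOEquiv (⟨ρ, hq⟩ : ActionOver q G) O g₀
  let f : Fin 3 → A := e.symm ∘ ![X 0, X 1, X 2]
  have hact : ∀ t : A, τ t = e.symm (σ (e t)) := fun t => by
    apply e.injective
    rw [e.apply_symm_apply, ← hστ]
    rfl
  have hactX : ∀ y, τ (e.symm y) = e.symm (σ y) := fun y => by rw [hact, e.apply_symm_apply]
  have hf0 : f 0 = e.symm (X 0) := rfl
  have hf1 : f 1 = e.symm (X 1) := rfl
  have hf2 : f 2 = e.symm (X 2) := rfl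
  have hw1 : (![3, 2, 1] : Fin 3 → ℕ) 1 = 2 := rfl
  have hw2 : (![3, 2, 1] : Fin 3 → ℕ) 2 = 1 := rfl
  have hinc0 : τ (f 0) - f 0 = 0 := by rw [hf0, hactX, h0, sub_self]
  have hinc1 : τ (f 1) - f 1 = 1 * 1 * f 0 := by rw [hf1, hactX, h1, map_add, hf0]; ring
  have hinc2 : τ (f 2) - f 2 = 1 * 1 * f 1 := by rw [hf2, hactX, h2, map_add, hf1]; ring
  have hinc3 : τ (e.symm (X 3)) - e.symm (X 3) = 1 * 1 * f 2 := by rw [hactX, h3, map_add, hf2]; ring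
  have hX0 : f 0 ∈ (weightedFiltration f ![3, 2, 1]).ideal 3 := mem_weightedFiltration_ideal f ![3, 2, 1] 0
  have hX1 : f 1 ∈ (weightedFiltration f ![3, 2, 1]).ideal 2 := mem_weightedFiltration_ideal f ![3, 2, 1] 1
  have hX2 : f 2 ∈ (weightedFiltration f ![3, 2, 1]).ideal 1 := mem_weightedFiltration_ideal f ![3, 2, 1] 2
  have h1J : ∀ {n : ℕ} {y : A}, y ∈ (weightedFiltration f ![3, 2, 1]).ideal n →
      1 * 1 * y ∈ Ideal.span {(1 : A)} * (weightedFiltration f ![3, 2, 1]).ideal n := fun hy => by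
    rw [one_mul]
    exact Ideal.mul_mem_mul (Ideal.mem_span_singleton_self _) hy
  -- (a′): `τ` moves `𝒥ₙ` within `𝒥ₙ₊₁` — checked on the generators `e⁻¹(C a)`, `e⁻¹(xᵢ)` of `A`
  have hgen : Subring.closure (e.symm '' (Set.range (C : k → MvPolynomial (Fin 4) k) ∪ Set.range (X : Fin 4 → MvPolynomial (Fin 4) k))) = ⊤ := by
    show Subring.closure ((e.symm : MvPolynomial (Fin 4) k →+* A) '' _) = ⊤
    rw [← RingHom.map_closure, closure_range_C_union_range_X k, ← RingHom.range_eq_map]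
    exact RingHom.range_eq_top.mpr e.symm.surjective
  have m0 : τ (e.symm (X 0)) - e.symm (X 0) ∈ Ideal.span {(1 : A)} * (weightedFiltration f ![3, 2, 1]).ideal 1 := by
    rw [← hf0, hinc0]; exact Ideal.zero_mem _
  have m1 : τ (e.symm (X 1)) - e.symm (X 1) ∈ Ideal.span {(1 : A)} * (weightedFiltration f ![3, 2, 1]).ideal 1 := by
    rw [← hf1, hinc1]; exact h1J ((weightedFiltration f ![3, 2, 1]).antitone (by norm_num : 1 ≤ 3) hX0)
  have m2 : τ (e.symm (X 2)) - e.symm (X 2) ∈ Ideal.span {(1 : A)} * (weightedFiltration f ![3, 2, 1]).ideal 1 := by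
    rw [← hf2, hinc2]; exact h1J ((weightedFiltration f ![3, 2, 1]).antitone (by norm_num : 1 ≤ 2) hX1)
  have m3 : τ (e.symm (X 3)) - e.symm (X 3) ∈ Ideal.span {(1 : A)} * (weightedFiltration f ![3, 2, 1]).ideal 1 := by
    rw [hinc3]; exact h1J hX2
  have hadm : ∀ (n : ℕ) (y : A), y ∈ (weightedFiltration f ![3, 2, 1]).ideal n →
      τ y - y ∈ Ideal.span {(1 : A)} * (weightedFiltration f ![3, 2, 1]).ideal (n + 1) := by
    refine admissible_of_generators f ![3, 2, 1] τ 1 _ hgen ?_ ?_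
    · rintro _ ⟨g, hg | hg, rfl⟩
      · obtain ⟨a, rfl⟩ := hg
        rw [hactX, hC, sub_self]; exact Ideal.zero_mem _
      · obtain ⟨i, rfl⟩ := hg
        fin_cases i
        exacts [m0, m1, m2, m3]
    · intro i
      fin_cases i
      · change τ (f 0) - f 0 ∈ _
        rw [hinc0]; exact Ideal.zero_mem _
      · change τ (f 1) - f 1 ∈ Ideal.span {(1 : A)} * (weightedFiltration f ![3, 2, 1]).ideal ((![3, 2, 1] : Fin 3 → ℕ) 1 + 1)
        rw [hinc1, hw1]; exact h1J hX0
      · change τ (f 2) - f 2 ∈ Ideal.span {(1 : A)} * (weightedFiltration f ![3, 2, 1]).ideal ((![3, 2, 1] : Fin 3 → ℕ) 2 + 1)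
        rw [hinc2, hw2]; exact h1J hX1
  have hσJ : ∀ n : ℕ, ((weightedFiltration f ![3, 2, 1]).ideal n).map (τ : A →+* A) ≤ (weightedFiltration f ![3, 2, 1]).ideal n :=
    map_le_of_admissible f ![3, 2, 1] τ 1 hadm
  -- (ii): isolation is trivial for `β = 1` — each `fᵢ` is itself an increment `τ y - y`
  have hiso : ∃ N : ℕ, Ideal.span (Set.range f) ^ N ≤ (augmentationIdeal τ).colon (Ideal.span {(1 : A)}) := by
    refine ⟨1, ?_⟩
    rw [pow_one, Ideal.span_le]
    rintro _ ⟨i, rfl⟩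
    rw [SetLike.mem_coe, Ideal.mem_colon_span_singleton, mul_one]
    fin_cases i
    · change f 0 ∈ _
      rw [show f 0 = 1 * 1 * f 0 by ring, ← hinc1]; exact sub_mem_augmentationIdeal _ _
    · change f 1 ∈ _
      rw [show f 1 = 1 * 1 * f 1 by ring, ← hinc2]; exact sub_mem_augmentationIdeal _ _
    · change f 2 ∈ _
      rw [show f 2 = 1 * 1 * f 2 by ring, ← hinc3]; exact sub_mem_augmentationIdeal _ _
  -- the certificate `g = s` (KC3 ∘ KC4′ with `β = h₁ = h₂ = h₃ = 1`, `x₄ = e⁻¹ x₃`)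
  have hcert : ∀ (hp' : 0 < p) (hσp : ∀ x, (⇑τ)^[p] x = x), ∃ g, CobordantKillCert f ![3, 2, 1] τ hσJ hp' hσp g := fun hp' hσp =>
    ⟨_, cobordantKillCert_jordanChainThree τ hp' hσp f 1 (e.symm (X 3)) 1 1 1 isUnit_one isUnit_one isUnit_one hσJ hadm hiso
      (by rw [hinc1, sub_self]; exact Ideal.zero_mem _) (by rw [hinc2, sub_self]; exact Ideal.zero_mem _)
      (by rw [hinc3, sub_self]; exact Ideal.zero_mem _)⟩
  -- K1′ in `A`, transported from `k[x]`
  have hK1 : RingTheory.Sequence.IsRegular A (List.ofFn f) :=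
    IsRegular.of_ringEquiv_ofFn e.symm ![X 0, X 1, X 2] (isRegular_X_zero_X_one_X_two k)
  have hK1' : IsRegularRing (A ⧸ Ideal.span (Set.range f)) :=
    isRegularRing_quotient_of_ringEquiv e.symm ![X 0, X 1, X 2] (isRegularRing_quotient_X_zero_X_one_X_two k)
  -- the cover theorem with the single chart `X′`
  obtain ⟨𝒦, d, hprin, hsupp, hchart, hfil, hZ⟩ := exists_isPrincipalCentre_filtration_eq_of_certCover (ι := Fin 1) hG hg₀
    (GModel.initial hq (stub_initialAtlas p hp q G ρ g₀ hg₀ hq hreg)) hreg (fun _ => O) (fun _ => hO)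
    (fun _ => 3) (fun _ => f) (fun _ => ![3, 2, 1]) (fun _ => by norm_num) (fun _ j => by fin_cases j <;> decide) (fun _ => hK1) (fun _ => hK1')
    (fun _ => hσJ) (fun _ => hcert) (fun _ _ _ _ _ _ => rfl)
    (B := X'.zeroLocus (U := ⊤) (Set.range f)) (X'.zeroLocus_isClosed _)
    (fun x _ => Set.mem_iUnion.mpr ⟨0, trivial⟩) (fun _ => Set.inter_subset_left)
  refine ⟨𝒦, d, hprin, hfil 0, le_antisymm hsupp fun x hx => hZ 0 ⟨hx, trivial⟩, fun O' hO' => ?_⟩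
  obtain rfl : O' = O := Subtype.ext hO'
  exact hchart 0

end Summit.ResolutionOfSingularities.ResolutionOfSingularities.Theorems.WildQuotientResolution.S1.GameFrame.GModel

end
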